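import Summits.BirchSwinnertonDyer.BirchSwinnertonDyer.Theorems.PrintCf2RubinValueTwoColemanCoinvariantCharTrace
import Literature.NumberTheory.GaloisRepresentations.LubinTateColemanCoordCoinvariantCosetTwo
import HarnessLib

/-!
# Brick (c) at `p = 2`, local `χ`-part: THE AUGMENTATION PAIR — if the `(σ̃ − 1)`-translates of the generators of `C₁` lie in `C₂`, then
# `(t_{χ(σ̃)}·C g_σ̃ − 1)·φ_ε(Col_Σ C₁) ⊆ φ_ε(Col_Σ C₂)`; with `σ̃` of Lubin–Tate character `γ` fixing `E_∞` and `σ̃` = Frobenius with trivial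
# character this is the height-two pair `(T, X)` of `Λ = 𝒪_F⟦X⟧⟦T⟧` (de Shalit II §4.12 / III Lemma 1.10: «ℐ·A ⊆ B», D4a/D4b of item D4χ)

Cell `bsd-print-cf2`, width seat `bsd-line-cf2c-w7` g26, route C `PrintCf2RubinValueTwo`, crux of record stmt-BirchSwinnertonDyer-24033
`TwoVariableMainConjAtSplitTwoQuad` (23720 nominal), BRICK §4(c), item D4χ (`BrickCD4Chi.BrickCD4ChiClosureComparison`; reduced to the two-sided
sandwich of the Coleman ideals by `BrickCD4Chi.brickCD4ChiClosureComparison_of_sandwich`); `--supports` the crux as a helper.  THEOREMS ONLY (0 sorry,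
no named fact, no definition); Theses-free.  BSD is not proved by any of this.

WHY.  The first half of the sandwich asks for a prime pair `f₁ ∤ g₁` of `Λ` with `f₁·I₁, g₁·I₁ ⊆ I₂`, `I_j = φ_ε(Col_Σ C_j)`, for `C₁ = A_χ` (closure of the
group generated by the averaged theta families `y_χ(𝔞)^{±1}`) and `C₂ = B_χ` (Shapiro image of Rubin's `𝒞̄`).  The arithmetic input (D4a, de Shalit's
`Θ(1;𝔪,𝔞)^{σ−1} ∈ 𝒞(K(𝔪))`, tree: `ThetaValueOneRubinUnits`) is LEVELWISE MEMBERSHIP: `(σ̃·y)(y)⁻¹ ∈ C₂` for the generators `y` and `σ̃ ∈ Γ_F`.  THIS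
file is the print-free passage from that membership to the ideal containment, for the generic lane data (any local `F` with `#𝓀 = 2`, any `d`):

* §1 `map_indexTraceₗ_galOpₗ` — `φ_ε(Σ 𝒯_{v,g,s} G) = (t_v·C g)·φ_ε(Σ G)` (`indexTraceₗ_galOpₗ` + `colemanDeltaCoinvFun_unitTwistₗ_smul`);
  ★ `colemanImage_galAct_mul_inv` — `Col((σ̃β)·β⁻¹) = 𝒯_σ̃(Col β) − Col β`; ★ `map_indexTraceₗ_colemanImage_galAct_mul_inv` —
  **`φ_ε(Σ Col((σ̃β)β⁻¹)) = (t_{χ(σ̃)}·C g_σ̃ − 1)·φ_ε(Σ Col β)`** for an Amice pair `(g_σ̃, s)` of `σ̃|_{E_∞}`.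
* §2 ★★ `smul_mem_map_colemanImageTrace_of_galAct_mul_inv_mem` — for `C₁ ⊆ closure ⟨β_c^{±1}⟩` (`β_c ∈ C₁`) and a closed `Γ_F`-stable subgroup `C₂` containing
  every `(σ̃β_c)β_c⁻¹`: **`(t_{χ(σ̃)}·C g_σ̃ − 1)·a ∈ I₂` for all `a ∈ I₁`** (generators by §1; closure by continuity of `φ_ε`, `Σ ∘ Col` and closedness of
  ideals of the Noetherian compact `Λ`, as in `ColemanCoinvariantTrace.map_colemanImageTrace_le_of_galois`).
* §3 ★★★ **`exists_prime_pair_smul_mem_of_forall_galAct_mul_inv_mem`** — if `(σ̃β_c)β_c⁻¹ ∈ C₂` for ALL `σ̃ ∈ Γ_F` and all `c`, then the PRIME PAIR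
  `(T, C X)` (`T ∤ C X`) satisfies `T·I₁ ⊆ I₂`, `C X·I₁ ⊆ I₂`: `T = t_γ − 1` from a `σ̃` fixing `E_∞` with `χ_π(σ̃) = γ`
  (`exists_absGal_fixing_forall_lubinTateChar_eq`, `colemanDeltaCoinvFun_unitTwistₗ_self_one`), `C X = t_1·C(1+X) − 1` from `σ₀·σ̃'` with `χ_π = 1` acting on
  `E_∞` as the Frobenius (Amice pair `(1+X, 1)`).  This is exactly the first input of `ColemanCoinvariantTraceSandwich.exists_…_of_sandwich`.

## References
* [deShalit1987] E. de Shalit, *Iwasawa theory of elliptic curves with complex multiplication* (1987), I §3.1, §3.4 Lemma (ii), §3.8 (17); II §4.12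
  (29)–(32); III §1.3–1.4 (5), Lemma 1.10 (17).
* [Rubin1991] K. Rubin, Invent. Math. 103 (1991), §4 p. 36.
* [Washington1997] L. C. Washington, *Introduction to Cyclotomic Fields* (1997), §7.1, §13.2.
* [BourbakiGT1] N. Bourbaki, *General Topology*, Ch. I §2.1.
-/

noncomputable section

set_option linter.dupNamespace false
set_option autoImplicit false

open Filter Topology
open scoped PowerSeries.WithPiTopology

namespace Summit.BirchSwinnertonDyer.BirchSwinnertonDyer.Theorems.PrintCf2.ColemanCoinvariantTraceAugmentation

open Literature.NumberTheory.GaloisRepresentations Literature.NumberTheory.GaloisRepresentations.IsNonarchimedeanLocalField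
  Literature.NumberTheory.GaloisRepresentations.LubinTate ValuativeRel Field
open Literature.NumberTheory.EllipticCurves
open Summit.BirchSwinnertonDyer.BirchSwinnertonDyer.Theorems.PrintCf2.ColemanImage
open Summit.BirchSwinnertonDyer.BirchSwinnertonDyer.Theorems.PrintCf2.ColemanCoinvariantTrace

variable {F : Type} [Field F] [ValuativeRel F] [TopologicalSpace F] [IsNonarchimedeanLocalField F]

attribute [local instance] ltNormUniformSpace ltNormIsUniformAddGroup rk1 nF nE fintypeResidueField
attribute [local instance] RelNormCoherentUnits.instCommMonoid
attribute [local instance] isAdicComplete_maximalIdeal_powerSeries_integer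

variable {p : ℕ} [hp : Fact p.Prime] {d : ℕ} (hd : d.Coprime p)
variable {π : 𝒪[F]} (hπ : (valuation F).IsUniformizer (π : F))
variable (E : ℕ → IntermediateField F (AlgebraicClosure F)) [∀ m, FiniteDimensional F (E m)] [∀ m, Normal F (E m)]
  [∀ m, IsGalois F (E m)] (hmono : Monotone E) (hE : ∀ m, E m ≤ maxUnramified F) (hdeg : ∀ m, Module.finrank F (E m) = d * p ^ m)
  {σ₀ : absoluteGaloisGroup F} (hσ₀ : IsAbsArithFrob σ₀) (hq : residueFieldCard F = 2)
variable (u : (LTCoeff F)ˣ) (hu : LTCoeff.of F π = residueFieldCard F * u) (γ w : 𝒪[F]ˣ) (hγ : (γ : 𝒪[F]) = 1 + π ^ 2 * w)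
variable [IsAdicComplete (Ideal.span {intBase F (LTCoeff.of F π)}) (PowerSeries 𝒪[F])] [NeZero d]
variable {θ : ∀ m, unitBall (E m)} (hθ : ∀ m, IsIntegralNormalGen (E m) (θ m))
  (hcoh : ∀ m, unitBallTrace (hmono (Nat.le_succ m)) (θ (m + 1)) = θ m)
variable [IsAdicComplete (Ideal.span {(p : 𝒪[F])}) 𝒪[F]]
  (hN : DenseRange (Nat.cast : ℕ → 𝒪[F]))
  (ε : PowerSeries (PowerSeries 𝒪[F]))

/-! ## §1. `φ_ε(Σ Col((σ̃β)β⁻¹)) = (t_{χ(σ̃)}·C g − 1)·φ_ε(Σ Col β)` -/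

omit hp [NeZero d] [IsAdicComplete (Ideal.span {(p : 𝒪[F])}) 𝒪[F]] in
/-- `φ_ε(Σ 𝒯_{v,g,s} G) = (t_v·C g)·φ_ε(Σ G)` (`t_v = φ_ε(σ_v 1)`): the trace kills the shift, the twist is a scalar on the `ε`-coinvariants.
[cite: deShalit1987, I §3.1, §3.4 Lemma (ii)] -/
theorem map_indexTraceₗ_galOpₗ [NeZero d] (hε : ε * ε = 1) (v : 𝒪[F]ˣ) (g : PowerSeries 𝒪[F]) (s : ZMod d)
    (G : ZMod d → ColemanCoordModule hπ hq (intBase F) u hu γ) :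
    colemanDeltaCoinvFun hπ hq (intBase F) u hu γ (eq_zero_of_C_pi_mul_eq_zero_integer hπ) w hγ ε
        (indexTraceₗ hπ hq u hu γ (galOpₗ hπ hq u hu γ v g s G)) =
      (colemanDeltaCoinvFun hπ hq (intBase F) u hu γ (eq_zero_of_C_pi_mul_eq_zero_integer hπ) w hγ ε
          (unitTwistₗ hπ hq (intBase F) u hu γ v (TActModule.ofPS _ _ 1)) * PowerSeries.C g) *
        colemanDeltaCoinvFun hπ hq (intBase F) u hu γ (eq_zero_of_C_pi_mul_eq_zero_integer hπ) w hγ ε (indexTraceₗ hπ hq u hu γ G) := by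
  rw [indexTraceₗ_galOpₗ, colemanDeltaCoinvFun_unitTwistₗ_smul hπ hq (intBase F) u hu γ _ w hγ ε hε]

include hdeg in
/-- ★ **`Col((σ̃β)·β⁻¹) = 𝒯_σ̃(Col β) − Col β`** for a principal coherent `β` and an Amice pair `(g, s)` of `σ̃|_{E_∞}` (`Col` is a homomorphism,
`Col(σ̃β) = 𝒯_σ̃ Col β`). [cite: deShalit1987, I §3.4 Lemma (i)–(ii), §3.8 (17); III §1.3] -/
theorem colemanImage_galAct_mul_inv {β : ∀ m, RelNormCoherentUnits hπ (E m)} (hβ : β ∈ principalCoherentFamilies hπ E hmono)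
    (σ : absoluteGaloisGroup F) {g : PowerSeries 𝒪[F]} {s : ZMod d}
    (hg : ∀ m, ∃ a : ℕ, (∀ x : E m, σ • (x : AlgebraicClosure F) = (σ₀ ^ a) • (x : AlgebraicClosure F)) ∧
      ((1 + PowerSeries.X : PowerSeries 𝒪[F]) ^ p ^ m - 1) ∣ g - (1 + PowerSeries.X) ^ a ∧ (a : ZMod d) = s)
    (h : ∀ m, (((β (m + 1)).galAct σ).mul ((β (m + 1)).inv hπ (E (m + 1)))).baseNorm hπ (hmono (Nat.le_succ m)) =
      ((β m).galAct σ).mul ((β m).inv hπ (E m))) :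
    colemanImage hd hπ E hmono hE hdeg hσ₀ hq u hu γ hθ hcoh (β := fun m => ((β m).galAct σ).mul ((β m).inv hπ (E m))) h =
      galOpₗ hπ hq u hu γ (lubinTateChar hπ σ) g s (colemanImage hd hπ E hmono hE hdeg hσ₀ hq u hu γ hθ hcoh hβ.1) -
        colemanImage hd hπ E hmono hE hdeg hσ₀ hq u hu γ hθ hcoh hβ.1 := by
  have hgal := galAct_mem_principalCoherentFamilies hπ E hmono hβ σ
  have hinv := inv_mem_principalCoherentFamilies hπ E hmono hβ
  rw [colemanImage_mul hd hπ E hmono hE hdeg hσ₀ hq u hu γ hθ hcoh (β := fun m => (β m).galAct σ) (β' := fun m => (β m).inv hπ (E m)) hgal.1 hinv.1 h,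
    colemanImage_galAct hd hπ E hmono hE hdeg hσ₀ hq u hu γ hθ hcoh hβ.1 σ hg, colemanImage_inv hd hπ E hmono hE hdeg hσ₀ hq u hu γ hθ hcoh hβ,
    sub_eq_add_neg]

include hdeg in
/-- ★ **`φ_ε(Σ Col((σ̃β)β⁻¹)) = (t_{χ(σ̃)}·C g_σ̃ − 1)·φ_ε(Σ Col β)`** — the `(σ̃ − 1)`-translate of a generator has Coleman value the generator's times the
augmentation element `t_{χ(σ̃)}·C g_σ̃ − 1` of `Λ(𝒢)`. [cite: deShalit1987, I §3.1, §3.4 Lemma (ii); II §4.12 (29); III §1.4 (5)] -/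
theorem map_indexTraceₗ_colemanImage_galAct_mul_inv (hε : ε * ε = 1) {β : ∀ m, RelNormCoherentUnits hπ (E m)}
    (hβ : β ∈ principalCoherentFamilies hπ E hmono) (σ : absoluteGaloisGroup F) {g : PowerSeries 𝒪[F]} {s : ZMod d}
    (hg : ∀ m, ∃ a : ℕ, (∀ x : E m, σ • (x : AlgebraicClosure F) = (σ₀ ^ a) • (x : AlgebraicClosure F)) ∧
      ((1 + PowerSeries.X : PowerSeries 𝒪[F]) ^ p ^ m - 1) ∣ g - (1 + PowerSeries.X) ^ a ∧ (a : ZMod d) = s)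
    (h : ∀ m, (((β (m + 1)).galAct σ).mul ((β (m + 1)).inv hπ (E (m + 1)))).baseNorm hπ (hmono (Nat.le_succ m)) =
      ((β m).galAct σ).mul ((β m).inv hπ (E m))) :
    colemanDeltaCoinvFun hπ hq (intBase F) u hu γ (eq_zero_of_C_pi_mul_eq_zero_integer hπ) w hγ ε
        (indexTraceₗ hπ hq u hu γ
          (colemanImage hd hπ E hmono hE hdeg hσ₀ hq u hu γ hθ hcoh (β := fun m => ((β m).galAct σ).mul ((β m).inv hπ (E m))) h)) =
      (colemanDeltaCoinvFun hπ hq (intBase F) u hu γ (eq_zero_of_C_pi_mul_eq_zero_integer hπ) w hγ ε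
          (unitTwistₗ hπ hq (intBase F) u hu γ (lubinTateChar hπ σ) (TActModule.ofPS _ _ 1)) * PowerSeries.C g - 1) *
        colemanDeltaCoinvFun hπ hq (intBase F) u hu γ (eq_zero_of_C_pi_mul_eq_zero_integer hπ) w hγ ε
          (indexTraceₗ hπ hq u hu γ (colemanImage hd hπ E hmono hE hdeg hσ₀ hq u hu γ hθ hcoh hβ.1)) := by
  rw [colemanImage_galAct_mul_inv hd hπ E hmono hE hdeg hσ₀ hq u hu γ hθ hcoh hβ σ hg h, map_sub, map_sub,
    map_indexTraceₗ_galOpₗ hπ hq u hu γ w hγ ε hε, sub_mul, one_mul]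

/-! ## §2. From the generators to the ideal: `(t_{χ(σ̃)}·C g_σ̃ − 1)·I₁ ⊆ I₂` -/

variable
  (C₁ : Set (∀ m, RelNormCoherentUnits hπ (E m))) (hC₁ : IsClosed C₁) (hC₁sub : C₁ ⊆ principalCoherentFamilies hπ E hmono)
  (h1₁ : (fun m => (RelNormCoherentUnits.one : RelNormCoherentUnits hπ (E m))) ∈ C₁)
  (hmul₁ : ∀ β ∈ C₁, ∀ β' ∈ C₁, (fun m => (β m).mul (β' m)) ∈ C₁) (hinv₁ : ∀ β ∈ C₁, (fun m => (β m).inv hπ (E m)) ∈ C₁)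
  (hgal₁ : ∀ σ : absoluteGaloisGroup F, ∀ β ∈ C₁, (fun m => (β m).galAct σ) ∈ C₁)
  (C₂ : Set (∀ m, RelNormCoherentUnits hπ (E m))) (hC₂ : IsClosed C₂) (hC₂sub : C₂ ⊆ principalCoherentFamilies hπ E hmono)
  (h1₂ : (fun m => (RelNormCoherentUnits.one : RelNormCoherentUnits hπ (E m))) ∈ C₂)
  (hmul₂ : ∀ β ∈ C₂, ∀ β' ∈ C₂, (fun m => (β m).mul (β' m)) ∈ C₂) (hinv₂ : ∀ β ∈ C₂, (fun m => (β m).inv hπ (E m)) ∈ C₂)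
  (hgal₂ : ∀ σ : absoluteGaloisGroup F, ∀ β ∈ C₂, (fun m => (β m).galAct σ) ∈ C₂)
  {I : Type*} (β : I → ∀ m, RelNormCoherentUnits hπ (E m)) (hβC₁ : ∀ c, β c ∈ C₁)
  (hC₁gen : C₁ ⊆ closure (Submonoid.closure (Set.range β ∪ Set.range fun c => fun m => ((β c) m).inv hπ (E m)) : Set _))

include hdeg hE hmono h1₁ hmul₁ hinv₁ hβC₁ hC₁gen in
/-- ★★ **THE AUGMENTATION CONTAINMENT.**  `C₁ ⊆ closure ⟨β_c^{±1}⟩` with `β_c ∈ C₁`, `C₂` a closed `Γ_F`-stable subgroup of `𝒰¹_∞`, `σ̃ ∈ Γ_F` with Amice pair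
`(g, s)`; if `(σ̃β_c)·β_c⁻¹ ∈ C₂` for every `c`, then **`(t_{χ(σ̃)}·C g − 1)·a ∈ φ_ε(Col_Σ C₂)` for every `a ∈ φ_ε(Col_Σ C₁)`**.
[cite: deShalit1987, II §4.12 (29)–(32); III §1.4 (5), Lemma 1.10] [cite: Washington1997, §13.2] [cite: BourbakiGT1, Ch. I §2.1 Th. 1] -/
theorem smul_mem_map_colemanImageTrace_of_galAct_mul_inv_mem (hε : ε * ε = 1) (σ : absoluteGaloisGroup F) {g : PowerSeries 𝒪[F]} {s : ZMod d}
    (hg : ∀ m, ∃ a : ℕ, (∀ x : E m, σ • (x : AlgebraicClosure F) = (σ₀ ^ a) • (x : AlgebraicClosure F)) ∧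
      ((1 + PowerSeries.X : PowerSeries 𝒪[F]) ^ p ^ m - 1) ∣ g - (1 + PowerSeries.X) ^ a ∧ (a : ZMod d) = s)
    (hmem : ∀ c, (fun m => ((β c m).galAct σ).mul ((β c m).inv hπ (E m))) ∈ C₂) :
    ∀ a ∈ (colemanImageTrace hd hπ E hmono hE hdeg hσ₀ hq u hu γ hθ hcoh hN C₁ hC₁ hC₁sub h1₁ hmul₁ hinv₁ hgal₁).map
        (colemanDeltaCoinvFun hπ hq (intBase F) u hu γ (eq_zero_of_C_pi_mul_eq_zero_integer hπ) w hγ ε),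
      (colemanDeltaCoinvFun hπ hq (intBase F) u hu γ (eq_zero_of_C_pi_mul_eq_zero_integer hπ) w hγ ε
          (unitTwistₗ hπ hq (intBase F) u hu γ (lubinTateChar hπ σ) (TActModule.ofPS _ _ 1)) * PowerSeries.C g - 1) • a ∈
      (colemanImageTrace hd hπ E hmono hE hdeg hσ₀ hq u hu γ hθ hcoh hN C₂ hC₂ hC₂sub h1₂ hmul₂ hinv₂ hgal₂).map
        (colemanDeltaCoinvFun hπ hq (intBase F) u hu γ (eq_zero_of_C_pi_mul_eq_zero_integer hπ) w hγ ε) := by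
  haveI : CompactSpace (PowerSeries 𝒪[F]) := PowerSeries.WithPiTopology.compactSpace _
  haveI : CompactSpace (PowerSeries (PowerSeries 𝒪[F])) := PowerSeries.WithPiTopology.compactSpace _
  set f : PowerSeries (PowerSeries 𝒪[F]) :=
    colemanDeltaCoinvFun hπ hq (intBase F) u hu γ (eq_zero_of_C_pi_mul_eq_zero_integer hπ) w hγ ε
        (unitTwistₗ hπ hq (intBase F) u hu γ (lubinTateChar hπ σ) (TActModule.ofPS _ _ 1)) * PowerSeries.C g - 1 with hf
  -- the continuous linear map `y ↦ f · φ_ε(y)`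
  let φ' : ColemanCoordModule hπ hq (intBase F) u hu γ →ₗ[PowerSeries (PowerSeries 𝒪[F])] PowerSeries (PowerSeries 𝒪[F]) :=
    f • colemanDeltaCoinvFun hπ hq (intBase F) u hu γ (eq_zero_of_C_pi_mul_eq_zero_integer hπ) w hγ ε
  have hφ' : Continuous φ' := (continuous_const.mul (continuous_colemanDeltaCoinvFun_intBase hπ hq u hu γ w hγ ε) :)
  -- generators land in `I₂`
  have hgenmem : ∀ c, φ' (indexTraceₗ hπ hq u hu γ (colemanImage hd hπ E hmono hE hdeg hσ₀ hq u hu γ hθ hcoh (hC₁sub (hβC₁ c)).1)) ∈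
      (colemanImageTrace hd hπ E hmono hE hdeg hσ₀ hq u hu γ hθ hcoh hN C₂ hC₂ hC₂sub h1₂ hmul₂ hinv₂ hgal₂).map
        (colemanDeltaCoinvFun hπ hq (intBase F) u hu γ (eq_zero_of_C_pi_mul_eq_zero_integer hπ) w hγ ε) := by
    intro c
    have hpcf : (fun m => ((β c m).galAct σ).mul ((β c m).inv hπ (E m))) ∈ principalCoherentFamilies hπ E hmono :=
      mul_mem_principalCoherentFamilies hπ E hmono (galAct_mem_principalCoherentFamilies hπ E hmono (hC₁sub (hβC₁ c)) σ)
        (inv_mem_principalCoherentFamilies hπ E hmono (hC₁sub (hβC₁ c)))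
    have e := map_indexTraceₗ_colemanImage_galAct_mul_inv hd hπ E hmono hE hdeg hσ₀ hq u hu γ w hγ hθ hcoh ε hε (hC₁sub (hβC₁ c)) σ hg hpcf.1
    change f * _ ∈ _
    rw [← e]
    exact Submodule.mem_map_of_mem
      (indexTraceₗ_colemanImage_mem_colemanImageTrace hd hπ E hmono hE hdeg hσ₀ hq u hu γ hθ hcoh hpcf (hmem c))
  have hle : (colemanImageTrace hd hπ E hmono hE hdeg hσ₀ hq u hu γ hθ hcoh hN C₁ hC₁ hC₁sub h1₁ hmul₁ hinv₁ hgal₁).map φ' ≤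
      (colemanImageTrace hd hπ E hmono hE hdeg hσ₀ hq u hu γ hθ hcoh hN C₂ hC₂ hC₂sub h1₂ hmul₂ hinv₂ hgal₂).map
        (colemanDeltaCoinvFun hπ hq (intBase F) u hu γ (eq_zero_of_C_pi_mul_eq_zero_integer hπ) w hγ ε) :=
    Submodule.map_le_of_subset_closure φ' hφ'
      (AddSubgroup.mapsTo_closure_range_of_forall_mem φ'
        (fun c => indexTraceₗ hπ hq u hu γ (colemanImage hd hπ E hmono hE hdeg hσ₀ hq u hu γ hθ hcoh (hC₁sub (hβC₁ c)).1)) _ hgenmem)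
      (Ideal.isClosed_of_isNoetherianRing _) _
      (colemanImageTrace_subset_closure hd hπ E hmono hE hdeg hσ₀ hq u hu γ hθ hcoh hN C₁ hC₁ hC₁sub h1₁ hmul₁ hinv₁ hgal₁ β hβC₁ hC₁gen)
  rintro a ⟨y, hy, rfl⟩
  exact hle (Submodule.mem_map_of_mem (f := φ') hy)

/-! ## §3. The augmentation PAIR `(T, C X)` -/

omit hp [NeZero d] [IsAdicComplete (Ideal.span {(p : 𝒪[F])}) 𝒪[F]] [TopologicalSpace F] [IsNonarchimedeanLocalField F] in
/-- `T` is prime in `Λ = 𝒪_F⟦X⟧⟦T⟧` and does not divide `C X` (constant term `X ≠ 0`). [cite: Washington1997, §7.1] -/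
theorem prime_X_and_not_dvd_C_X :
    Prime (PowerSeries.X : PowerSeries (PowerSeries 𝒪[F])) ∧
      ¬ (PowerSeries.X : PowerSeries (PowerSeries 𝒪[F])) ∣ PowerSeries.C (PowerSeries.X : PowerSeries 𝒪[F]) := by
  refine ⟨PowerSeries.X_prime, fun h ↦ ?_⟩
  rw [PowerSeries.X_dvd_iff, PowerSeries.constantCoeff_C] at h
  exact PowerSeries.X_ne_zero h

include hdeg hE hmono hσ₀ h1₁ hmul₁ hinv₁ hβC₁ hC₁gen in
/-- ★★★ **THE AUGMENTATION PAIR.**  If `(σ̃β_c)·β_c⁻¹ ∈ C₂` for EVERY `σ̃ ∈ Γ_F` and every generator `β_c` of `C₁`, then the prime pair `(T, C X)` of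
`Λ = 𝒪_F⟦X⟧⟦T⟧` (`T ∤ C X`) satisfies `T·I₁ ⊆ I₂` and `C X·I₁ ⊆ I₂`, `I_j = φ_ε(Col_Σ C_j)`: `T = t_γ − 1` is the multiplier of a `σ̃` fixing `E_∞` with
`χ_π(σ̃) = γ`, `C X = t_1·C(1+X) − 1` that of `σ₀σ̃'` with `χ_π(σ̃') = χ_π(σ₀)⁻¹`, `σ̃'` fixing `E_∞`.  The first input of the two-sided sandwich
(`ColemanCoinvariantTraceSandwich`), i.e. «`ℐ·A ⊆ B` up to the height-two ideal `ℐ = (T, X)`».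
[cite: deShalit1987, II §4.12 (29)–(32); III §1.4 (5), Lemma 1.10 (17)] [cite: Washington1997, §13.2] -/
theorem exists_prime_pair_smul_mem_of_forall_galAct_mul_inv_mem (hε : ε * ε = 1)
    (hmem : ∀ σ : absoluteGaloisGroup F, ∀ c, (fun m => ((β c m).galAct σ).mul ((β c m).inv hπ (E m))) ∈ C₂) :
    ∃ f g : PowerSeries (PowerSeries 𝒪[F]), Prime f ∧ ¬ f ∣ g ∧
      (∀ a ∈ (colemanImageTrace hd hπ E hmono hE hdeg hσ₀ hq u hu γ hθ hcoh hN C₁ hC₁ hC₁sub h1₁ hmul₁ hinv₁ hgal₁).map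
          (colemanDeltaCoinvFun hπ hq (intBase F) u hu γ (eq_zero_of_C_pi_mul_eq_zero_integer hπ) w hγ ε),
        f • a ∈ (colemanImageTrace hd hπ E hmono hE hdeg hσ₀ hq u hu γ hθ hcoh hN C₂ hC₂ hC₂sub h1₂ hmul₂ hinv₂ hgal₂).map
          (colemanDeltaCoinvFun hπ hq (intBase F) u hu γ (eq_zero_of_C_pi_mul_eq_zero_integer hπ) w hγ ε)) ∧
      (∀ a ∈ (colemanImageTrace hd hπ E hmono hE hdeg hσ₀ hq u hu γ hθ hcoh hN C₁ hC₁ hC₁sub h1₁ hmul₁ hinv₁ hgal₁).map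
          (colemanDeltaCoinvFun hπ hq (intBase F) u hu γ (eq_zero_of_C_pi_mul_eq_zero_integer hπ) w hγ ε),
        g • a ∈ (colemanImageTrace hd hπ E hmono hE hdeg hσ₀ hq u hu γ hθ hcoh hN C₂ hC₂ hC₂sub h1₂ hmul₂ hinv₂ hgal₂).map
          (colemanDeltaCoinvFun hπ hq (intBase F) u hu γ (eq_zero_of_C_pi_mul_eq_zero_integer hπ) w hγ ε)) := by
  obtain ⟨hTprime, hTX⟩ := prime_X_and_not_dvd_C_X (F := F)
  -- `σ̃_T`: fixes `E_∞`, `χ_π = γ`, Amice pair `(1, 0)`, multiplier `t_γ·C 1 − 1 = T`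
  obtain ⟨σT, hσTE, hσTχ⟩ := exists_absGal_fixing_forall_lubinTateChar_eq hπ E hmono hE γ
  have hT := smul_mem_map_colemanImageTrace_of_galAct_mul_inv_mem hd hπ E hmono hE hdeg hσ₀ hq u hu γ w hγ hθ hcoh hN ε C₁ hC₁ hC₁sub h1₁ hmul₁
    hinv₁ hgal₁ C₂ hC₂ hC₂sub h1₂ hmul₂ hinv₂ hgal₂ β hβC₁ hC₁gen hε σT (g := 1) (s := 0)
    (fun m => amicePair_galois_of_forall_smul_eq (p := p) (d := d) (E := E) (σ₀' := σ₀) hσTE m) (hmem σT)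
  rw [hσTχ, colemanDeltaCoinvFun_unitTwistₗ_self_one, map_one, mul_one, add_sub_cancel_left] at hT
  -- `σ̃_X := σ₀·σ̃'`, `σ̃'` fixing `E_∞` with `χ_π(σ̃') = χ_π(σ₀)⁻¹`: `χ_π = 1`, Amice pair `(1 + X, 1)`, multiplier `C(1+X) − 1 = C X`
  obtain ⟨σ', hσ'E, hσ'χ⟩ := exists_absGal_fixing_forall_lubinTateChar_eq hπ E hmono hE (lubinTateChar hπ σ₀)⁻¹
  have hgX : ∀ m, ∃ a : ℕ, (∀ x : E m, (σ₀ * σ') • (x : AlgebraicClosure F) = (σ₀ ^ a) • (x : AlgebraicClosure F)) ∧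
      ((1 + PowerSeries.X : PowerSeries 𝒪[F]) ^ p ^ m - 1) ∣ (1 + PowerSeries.X : PowerSeries 𝒪[F]) - (1 + PowerSeries.X) ^ a ∧
        (a : ZMod d) = 1 := fun m =>
    ⟨1, fun x => by rw [mul_smul, hσ'E, pow_one], by rw [pow_one, sub_self]; exact dvd_zero _, Nat.cast_one⟩
  have hX := smul_mem_map_colemanImageTrace_of_galAct_mul_inv_mem hd hπ E hmono hE hdeg hσ₀ hq u hu γ w hγ hθ hcoh hN ε C₁ hC₁ hC₁sub h1₁ hmul₁
    hinv₁ hgal₁ C₂ hC₂ hC₂sub h1₂ hmul₂ hinv₂ hgal₂ β hβC₁ hC₁gen hε (σ₀ * σ') hgX (hmem (σ₀ * σ'))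
  have hχ : lubinTateChar hπ (σ₀ * σ') = 1 := by rw [lubinTateChar_mul, hσ'χ, mul_inv_cancel]
  rw [hχ, colemanDeltaCoinvFun_unitTwistₗ_one_one, one_mul, map_add, map_one, add_sub_cancel_left] at hX
  exact ⟨PowerSeries.X, PowerSeries.C PowerSeries.X, hTprime, hTX, hT, hX⟩

end Summit.BirchSwinnertonDyer.BirchSwinnertonDyer.Theorems.PrintCf2.ColemanCoinvariantTraceAugmentation

end
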